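import Literature.AlgebraicGeometry.Resolution.KummerRootCover
import Literature.AlgebraicGeometry.Resolution.RegularParameterQuotient
import Literature.RingTheory.KrullDimension.AffineDimension
import Mathlib.RingTheory.Ideal.GoingUp
import Mathlib.RingTheory.RegularLocalRing.Defs
import HarnessLib

/-!
# The Kummer root cover of a regular local ring at regular parameters is regular local

Topic: `Literature/AlgebraicGeometry/Resolution`. Sequel to `KummerRootCover.lean`
(`RootCover p x = O[s_1, …, s_r]/(s_j^p - x_j)` with its monomial `O`-basis). For a local ring
`(O, 𝔪)` and `x_j ∈ 𝔪` the cover `B'` is LOCAL with maximal ideal `𝔐 = 𝔪 B' + (s_1, …, s_r)`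
(`RootCover.isLocalRing`; via the augmentation `s ↦ 0` onto `O/(x)`, `RootCover.augment`, and
integrality), and for a regular local ring `O` with `x` part of a regular system of parameters
(independent modulo `𝔪²`) it is a REGULAR local ring of the same dimension
(`RootCover.isRegularLocalRing`: `𝔐 = (y_i, s_j)` for lifts `y_i` of `dim O - r` generators of
the maximal ideal of the regular ring `O/(x)`, Matsumura 14.2, and `x_j = s_j^p`). This is the
regular (Kummer-étale-free) model inside which the normalised `p`-cyclic Kummer cover of an snc
boundary sits as the invariant subring of a diagonalisable group-scheme action — K. Kato,
*Toric singularities*, Amer. J. Math. 116 (1994), (2.2)(2), Thm. (4.1) — used by the endgame of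
the crux `PicoverLocalModel` (line `giraud-cossart-normal-form`).

* `RootCover.augment`, `augment_root`, `augment_boxMonomial`, `augment_surjective`;
* `RootCover.maxIdeal`, `maxIdeal_eq_comap`, `RootCover.isLocalRing`;
* `RootCover.algebraMap_injective`, `RootCover.isRegularLocalRing` (with `dim B' = dim O`).

Sources: [Kato1994] K. Kato, Amer. J. Math. 116 (1994), (2.2)(2), (4.1). [Matsumura1987]
H. Matsumura, *Commutative Ring Theory*, Thm. 14.2. All statements PROVED.
-/

noncomputable section

namespace Literature.AlgebraicGeometry.Resolution

open MvPolynomial IsLocalRing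

namespace RootCover

variable {O : Type*} [CommRing O] {r : ℕ} {p : ℕ} {x : Fin r → O}

/-! ## The augmentation `s ↦ 0` onto `O/(x)` -/

variable (p x) in
/-- **The augmentation** `O[s]/(s^p - x) → O/(x)`, `s_j ↦ 0` (well defined since
`s_j^p - x_j ↦ -x̄_j = 0`; `0 < p`). [folklore] -/
def augment (hp : 0 < p) : RootCover p x →ₐ[O] O ⧸ Ideal.span (Set.range x) :=
  Ideal.Quotient.liftₐ (rootCoverIdeal p x)
    (MvPolynomial.aeval fun _ : Fin r => (0 : O ⧸ Ideal.span (Set.range x))) (by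
      intro F hF
      refine Submodule.span_induction (p := fun F _ => MvPolynomial.aeval _ F = 0) ?_ ?_ ?_ ?_ hF
      · rintro _ ⟨j, rfl⟩
        rw [map_sub, map_pow, aeval_X, zero_pow hp.ne', zero_sub, neg_eq_zero, aeval_C,
          Ideal.Quotient.algebraMap_eq, Ideal.Quotient.eq_zero_iff_mem]
        exact Ideal.subset_span ⟨j, rfl⟩
      · simp
      · intro a b _ _ ha hb; rw [map_add, ha, hb, add_zero]
      · intro a b _ hb; rw [smul_eq_mul, map_mul, hb, mul_zero])

/-- The augmentation kills the roots. [folklore] -/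
@[simp] theorem augment_root (hp : 0 < p) (j : Fin r) : augment p x hp (root p x j) = 0 := by
  change Ideal.Quotient.liftₐ _ _ _ (Ideal.Quotient.mk _ (X j)) = 0
  rw [Ideal.Quotient.liftₐ_apply, Ideal.Quotient.lift_mk]
  exact aeval_X _ j

/-- The augmentation on scalars is the quotient map. [folklore] -/
theorem augment_algebraMap (hp : 0 < p) (a : O) :
    augment p x hp (algebraMap O _ a) = Ideal.Quotient.mk _ a :=
  AlgHom.commutes _ a

/-- The augmentation is surjective. [folklore] -/
theorem augment_surjective (hp : 0 < p) : Function.Surjective (augment p x hp) := by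
  intro b
  obtain ⟨a, rfl⟩ := Ideal.Quotient.mk_surjective b
  exact ⟨algebraMap O _ a, augment_algebraMap hp a⟩

/-- The augmentation of a box monomial: `1` for the empty monomial, `0` otherwise. [folklore] -/
theorem augment_boxMonomial [Fact p.Prime] (n : Fin r → Fin p) :
    augment p x (Fact.out : p.Prime).pos (boxMonomial p x n) = if n = 0 then 1 else 0 := by
  rw [boxMonomial, map_prod]
  simp only [map_pow, augment_root]
  split_ifs with h
  · subst h
    simp
  · obtain ⟨j, hj⟩ : ∃ j, n j ≠ 0 := by
      by_contra hall
      push Not at hall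
      exact h (funext hall)
    apply Finset.prod_eq_zero (Finset.mem_univ j)
    rw [zero_pow]
    exact fun h0 => hj (Fin.ext (by simpa using h0))

/-- **The augmentation reads off the coordinate at the empty monomial**: `augment b = coord₀(b)`
modulo `(x)`. [folklore] -/
theorem augment_eq_mk_coord_zero [Fact p.Prime] (b : RootCover p x) :
    augment p x (Fact.out : p.Prime).pos b = Ideal.Quotient.mk _ (coord b 0) := by
  have hrepr : b = ∑ n, coord b n • boxMonomial p x n := by
    conv_lhs => rw [← (basis p x).sum_repr b]
    simp only [basis_apply, coord_apply_eq_repr]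
  conv_lhs => rw [hrepr]
  rw [map_sum]
  simp only [map_smul, augment_boxMonomial, smul_ite, smul_zero]
  rw [Finset.sum_ite_eq' Finset.univ (0 : Fin r → Fin p)]
  simp [Algebra.smul_def]

section Local

variable [IsLocalRing O] [Fact p.Prime]

/-- The ideal `𝔐 = 𝔪·B' + (s_1, …, s_r)` of the root cover `B'`. [folklore] -/
def maxIdeal (p : ℕ) (x : Fin r → O) : Ideal (RootCover p x) :=
  (maximalIdeal O).map (algebraMap O (RootCover p x)) ⊔ Ideal.span (Set.range (root p x))

/-- **`𝔐` is the preimage of the maximal ideal of `O/(x)` under the augmentation** (for `x_j`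
in the maximal ideal). [folklore] -/
theorem maxIdeal_eq_comap (hx : ∀ j, x j ∈ maximalIdeal O) [Nontrivial (O ⧸ Ideal.span (Set.range x))] :
    letI := IsLocalRing.of_surjective' (Ideal.Quotient.mk (Ideal.span (Set.range x)))
      Ideal.Quotient.mk_surjective
    maxIdeal p x = (maximalIdeal (O ⧸ Ideal.span (Set.range x))).comap
      (augment p x (Fact.out : p.Prime).pos) := by
  letI := IsLocalRing.of_surjective' (Ideal.Quotient.mk (Ideal.span (Set.range x)))
    Ideal.Quotient.mk_surjective
  have hp : p.Prime := Fact.out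
  have _ := hx
  have hmax : maximalIdeal (O ⧸ Ideal.span (Set.range x)) =
      (maximalIdeal O).map (Ideal.Quotient.mk _) := maximalIdeal_quotient_eq_map _
  apply le_antisymm
  · refine sup_le ?_ ?_
    · rw [Ideal.map_le_iff_le_comap]
      intro a ha
      rw [Ideal.mem_comap, Ideal.mem_comap, augment_algebraMap, hmax]
      exact Ideal.mem_map_of_mem _ ha
    · rw [Ideal.span_le]
      rintro _ ⟨j, rfl⟩
      rw [SetLike.mem_coe, Ideal.mem_comap, augment_root]
      exact Ideal.zero_mem _
  · intro b hb
    rw [Ideal.mem_comap] at hb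
    -- expand `b` in the monomial basis
    have hrepr : b = ∑ n, coord b n • boxMonomial p x n := by
      conv_lhs => rw [← (basis p x).sum_repr b]
      simp only [basis_apply, coord_apply_eq_repr]
    have haug : augment p x hp.pos b = Ideal.Quotient.mk _ (coord b 0) :=
      augment_eq_mk_coord_zero b
    rw [haug, hmax, Ideal.mem_quotient_iff_mem_sup] at hb
    have hI : Ideal.span (Set.range x) ≤ maximalIdeal O :=
      Ideal.span_le.mpr (by rintro _ ⟨j, rfl⟩; exact hx j)
    rw [sup_eq_left.mpr hI] at hb
    rw [hrepr, ← Finset.sum_erase_add _ _ (Finset.mem_univ 0)]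
    refine Ideal.add_mem _ (Ideal.sum_mem _ fun n hn => ?_) ?_
    · -- a non-empty box monomial lies in `(s)`
      refine Ideal.mem_sup_right ?_
      rw [Algebra.smul_def]
      refine Ideal.mul_mem_left _ _ ?_
      obtain ⟨j, hj⟩ : ∃ j, n j ≠ 0 := by
        by_contra hall
        push Not at hall
        exact (Finset.ne_of_mem_erase hn) (funext hall)
      rw [boxMonomial, ← Finset.mul_prod_erase _ _ (Finset.mem_univ j)]
      refine Ideal.mul_mem_right _ _
        (Ideal.pow_mem_of_mem _ (Ideal.subset_span (s := Set.range (root p x)) ⟨j, rfl⟩) _ ?_)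
      exact Nat.pos_of_ne_zero fun h0 => hj (Fin.ext (by simpa using h0))
    · refine Ideal.mem_sup_left ?_
      rw [Algebra.smul_def]
      exact Ideal.mul_mem_right _ _ (Ideal.mem_map_of_mem _ hb)

/-- **The root cover of a local ring at elements of the maximal ideal is local**, with maximal
ideal `𝔐 = 𝔪·B' + (s)`: `𝔐` is maximal (preimage of the maximal ideal of `O/(x)` under the
surjective augmentation), and every maximal ideal of `B'` contains `𝔪` (integrality) hence the
`x_j = s_j^p`, hence the `s_j`, hence `𝔐`. [cite: Kato1994, (2.2)(2)] -/
theorem isLocalRing (hx : ∀ j, x j ∈ maximalIdeal O) :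
    ∃ _ : IsLocalRing (RootCover p x), maximalIdeal (RootCover p x) = maxIdeal p x := by
  have hp : p.Prime := Fact.out
  have hI : Ideal.span (Set.range x) ≤ maximalIdeal O :=
    Ideal.span_le.mpr (by rintro _ ⟨j, rfl⟩; exact hx j)
  haveI : Nontrivial (O ⧸ Ideal.span (Set.range x)) :=
    Ideal.Quotient.nontrivial_iff.mpr (ne_top_of_le_ne_top (maximalIdeal.isMaximal O).ne_top hI)
  letI := IsLocalRing.of_surjective' (Ideal.Quotient.mk (Ideal.span (Set.range x)))
    Ideal.Quotient.mk_surjective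
  have hM : (maxIdeal p x).IsMaximal := by
    rw [maxIdeal_eq_comap hx]
    exact Ideal.comap_isMaximal_of_surjective _ (augment_surjective hp.pos)
  haveI : Algebra.IsIntegral O (RootCover p x) := inferInstance
  have hunique : ∀ 𝔑 : Ideal (RootCover p x), 𝔑.IsMaximal → 𝔑 = maxIdeal p x := by
    intro 𝔑 h𝔑
    refine (hM.eq_of_le h𝔑.ne_top ?_).symm
    have hcomap : 𝔑.comap (algebraMap O (RootCover p x)) = maximalIdeal O := by
      haveI := Ideal.isMaximal_comap_of_isIntegral_of_isMaximal (R := O) 𝔑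
      exact IsLocalRing.eq_maximalIdeal inferInstance
    refine sup_le (Ideal.map_le_iff_le_comap.mpr hcomap.ge) (Ideal.span_le.mpr ?_)
    rintro _ ⟨j, rfl⟩
    refine h𝔑.isPrime.mem_of_pow_mem p ?_
    rw [root_pow]
    exact Ideal.mem_comap.mp (hcomap.symm ▸ hx j)
  haveI : IsLocalRing (RootCover p x) := IsLocalRing.of_unique_max_ideal ⟨maxIdeal p x, hM, hunique⟩
  exact ⟨inferInstance, (hunique _ (maximalIdeal.isMaximal _)).trans rfl⟩

end Local

/-! ## Regularity -/

section Regular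

variable [IsRegularLocalRing O] [Fact p.Prime]

omit [IsRegularLocalRing O] in
/-- The structure map of the root cover is injective (read off the coordinate at the empty
monomial). [folklore] -/
theorem algebraMap_injective : Function.Injective (algebraMap O (RootCover p x)) := by
  intro a b hab
  have h : coord (algebraMap O (RootCover p x) a) 0 = coord (algebraMap O (RootCover p x) b) 0 := by
    rw [hab]
  have key : ∀ c : O, coord (algebraMap O (RootCover p x) c) 0 = c := fun c => by
    have : algebraMap O (RootCover p x) c = c • boxMonomial p x 0 := by
      rw [Algebra.algebraMap_eq_smul_one]; congr 1
      simp [boxMonomial]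
    rw [this, map_smul, Pi.smul_apply, coord_boxMonomial, Pi.single_eq_same, smul_eq_mul, mul_one]
  rwa [key, key] at h

/-- **The root cover of a regular local ring at regular parameters is a regular local ring**
(of the same dimension): with `O/(x)` regular of dimension `dim O - r` (Matsumura 14.2), its
maximal ideal is generated by `dim O - r` elements `ȳ_i`; then `𝔐 = 𝔪B' + (s) = (y_i, s_j)`
(`x_j = s_j^p`) needs `dim O = dim B'` generators. [cite: Kato1994, (2.2)(2)] -/
theorem isRegularLocalRing (hx : ∀ j, x j ∈ maximalIdeal O)
    (hli : ∀ α : Fin r → O, ∑ i, α i * x i ∈ maximalIdeal O ^ 2 → ∀ i, α i ∈ maximalIdeal O) :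
    IsRegularLocalRing (RootCover p x) ∧ ringKrullDim (RootCover p x) = ringKrullDim O := by
  classical
  have hp : p.Prime := Fact.out
  obtain ⟨hloc, hmax⟩ := isLocalRing (p := p) hx
  haveI := hloc
  haveI : IsNoetherianRing (RootCover p x) := IsNoetherianRing.of_finite O (RootCover p x)
  haveI : Algebra.IsIntegral O (RootCover p x) := inferInstance
  have hdim : ringKrullDim (RootCover p x) = ringKrullDim O :=
    (Literature.RingTheory.KrullDimension.ringKrullDim_eq_of_isIntegral algebraMap_injective).symm
  refine ⟨IsRegularLocalRing.of_spanFinrank_maximalIdeal_le _ ?_, hdim⟩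
  -- generators of the maximal ideal of `O/(x)`
  obtain ⟨hregQ, hdimQ⟩ := RegularParameters.isRegularLocalRing_quotient_span_range x hx hli
  haveI := hregQ
  set Q := O ⧸ Ideal.span (Set.range x)
  have hfgQ : Submodule.FG (R := Q) (M := Q) (maximalIdeal Q) := IsNoetherian.noetherian _
  set G : Set Q := (maximalIdeal Q).generators with hG
  have hGfin : G.Finite := hfgQ.finite_generators
  have hGcard : (G.ncard : WithBot ℕ∞) = ringKrullDim Q := by
    rw [hfgQ.generators_ncard, ← (isRegularLocalRing_iff Q).mp hregQ]
  -- lift them to `O`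
  let Y : Set O := Quotient.out '' G
  have hYfin : Y.Finite := hGfin.image _
  have hYcard : Y.ncard ≤ G.ncard := Set.ncard_image_le hGfin
  have hmO : maximalIdeal O = Ideal.span (Set.range x) ⊔ Ideal.span Y := by
    apply le_antisymm
    · intro a ha
      have : Ideal.Quotient.mk (Ideal.span (Set.range x)) a ∈ Submodule.span Q G := by
        rw [hG, Submodule.span_generators, maximalIdeal_quotient_eq_map]
        exact Ideal.mem_map_of_mem _ ha
      have hspan : Submodule.span Q G = (Ideal.span Y).map (Ideal.Quotient.mk _) := by
        rw [Ideal.map_span]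
        congr 1
        ext q
        simp only [Y, Set.mem_image, exists_exists_and_eq_and, Ideal.Quotient.mk_out]
        simp
      rw [hspan, Ideal.mem_quotient_iff_mem_sup, sup_comm] at this
      exact this
    · refine sup_le (Ideal.span_le.mpr ?_) (Ideal.span_le.mpr ?_)
      · rintro _ ⟨j, rfl⟩; exact hx j
      · rintro _ ⟨q, hq, rfl⟩
        have hq' : q ∈ maximalIdeal Q := by
          rw [← Submodule.span_generators (maximalIdeal Q)]
          exact Submodule.subset_span hq
        rw [maximalIdeal_quotient_eq_map] at hq'
        rw [← Ideal.Quotient.mk_out q, Ideal.mem_quotient_iff_mem_sup, sup_eq_left.mpr] at hq'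
        · exact hq'
        · exact Ideal.span_le.mpr (by rintro _ ⟨j, rfl⟩; exact hx j)
  -- `𝔐 = (algebraMap Y, roots)`
  let S : Set (RootCover p x) := algebraMap O (RootCover p x) '' Y ∪ Set.range (root p x)
  have hSfin : S.Finite := (hYfin.image _).union (Set.finite_range _)
  have hMS : maximalIdeal (RootCover p x) = Ideal.span S := by
    rw [hmax, maxIdeal, hmO, Ideal.map_sup, Ideal.map_span, Ideal.map_span, Ideal.span_union]
    apply le_antisymm
    · refine sup_le (sup_le (Ideal.span_le.mpr ?_) le_sup_left) le_sup_right
      rintro _ ⟨_, ⟨j, rfl⟩, rfl⟩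
      rw [← root_pow]
      exact Ideal.pow_mem_of_mem _
        (Ideal.mem_sup_right (Ideal.subset_span (s := Set.range (root p x)) ⟨j, rfl⟩)) _ hp.pos
    · exact sup_le (le_sup_left.trans' le_sup_right) le_sup_right
  -- count
  have hScard : S.ncard ≤ Y.ncard + r := by
    refine (Set.ncard_union_le _ _).trans (add_le_add (Set.ncard_image_le hYfin) ?_)
    calc (Set.range (root p x)).ncard ≤ (Set.univ : Set (Fin r)).ncard := by
          rw [← Set.image_univ]; exact Set.ncard_image_le Set.finite_univ
      _ = r := by rw [Set.ncard_univ, Nat.card_eq_fintype_card, Fintype.card_fin]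
  have h1 : ((maximalIdeal (RootCover p x)).spanFinrank : WithBot ℕ∞) ≤ (Y.ncard + r : ℕ) := by
    rw [hMS]
    exact_mod_cast (Submodule.spanFinrank_span_le_ncard_of_finite hSfin).trans hScard
  refine h1.trans ?_
  rw [hdim, ← hdimQ, ← hGcard, Nat.cast_add]
  exact add_le_add (by exact_mod_cast hYcard) le_rfl

end Regular

end RootCover

end Literature.AlgebraicGeometry.Resolution

end
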